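import Literature.AlgebraicGeometry.Motives.MumfordTateGroupOfOrientationComplexPoints
import Literature.AlgebraicGeometry.Motives.HodgeStructureOfOrientationReflexNormTorus
import HarnessLib

/-!
# `η(N_{Π′}(F′^{,*})) ⊂ M_φ̃(ℚ)` — Green–Griffiths–Kerr (V.D.4), left member, on rational points, in every weight

[topic AlgebraicGeometry/Motives]

Layer `Literature/AlgebraicGeometry/Motives`, lane `lit-hodgefound` (Track 2 foundations library; seat `lit-hodgefound-p02`, gen 26,
row g26-#4 FILE 2).  THEOREMS ONLY (no definition, no named fact; net debt `0`).  Joins FILE 1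
`Motives/HodgeStructureOfOrientationReflexNormTorus` (`prod_embedding_reflexNormHom_zpow_eq_one`: `N_{Π′}(α)` is killed by every
character orthogonal to the translated degree vectors) with g26-#2 `Motives/MumfordTateGroupOfOrientationComplexPoints`
(`mulRight_mem_mumfordTateGroup_ofOrientation` / `mem_mumfordTateGroup_ofOrientation_iff`: `MT(V^n_{(F,Π)})(ℚ) = {x ∈ F^× | χ_c(x) = 1
for all c ⊥ W}`).

THE PRINT (held text `book:green2012-mumford-tate-groups-domains-their-geometry-arithmetic`, (V.D.4) p. 164): «`η(N_{Π̃^{-1}}(F^{c,*})) =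
η(N_{Π′}(F′^{,*})) ⊂ M_φ̃(ℚ) ⊂ η(F) ⊂ E_φ`.»

WHAT IS PROVED.  **`mulRight_reflexNormHom_mem_mumfordTateGroup_ofOrientation`**: for every `α ∈ (F′)^×`, multiplication by
`N_{Π′}(α) ∈ F^×` on `V = F` lies in `MT(V^n_{(F,Π)})(ℚ)` (the tree's Tannaka-free `mumfordTateGroup` of `Ξ(F,Π) = ofOrientation Π`) —
«`η(N_{Π′}(F′^{,*})) ⊂ M_φ̃(ℚ)`» AS PRINTED (every weight, `F^c = L` a CM Galois number field); `exists_mem_mumfordTateGroup_ofOrientation_apply_one_eq_reflexNormHom`.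
NOT here: «`Im(𝒩_{Π′}) = M_φ̃`» as algebraic groups, nor the equality of images with `N_{Π̃⁻¹}`.

## References
* [GreenGriffithsKerr2012] M. Green, P. Griffiths, M. Kerr, *Mumford–Tate Groups and Domains: Their Geometry and Arithmetic*, Ann. of
  Math. Stud. 183 (2012): (V.D.4) p. 164; §V.F p. 172.
* [Deligne1982HodgeCycles] P. Deligne, *Hodge cycles on abelian varieties*, LNM 900 (1982), I Ex. 3.7 (b), (c).
-/

noncomputable section

open scoped Pointwise

open NumberField Module

namespace Literature.AlgebraicGeometry.Motives

namespace HodgeStructure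

namespace Orientation

open Literature.NumberTheory.ComplexMultiplication

variable {L : Type} [Field L] [NumberField L] [IsGalois ℚ L] [IsCMField L] {M : Type} [Field M] [NumberField M] {m : ℤ}
  [HodgeTensorFacts.{0, 0}] (Λ : Orientation M m) (j : M →ₐ[ℚ] L) (ι : L →+* ℂ)

/-- **GGK (V.D.4) «`η(N_{Π′}(F′^{,*})) ⊂ M_φ̃(ℚ)`», AS PRINTED, in every weight**: for every unit `α` of the reflex field `F′` the
rational automorphism "multiplication by `N_{Π′}(α)`" of `V = F` lies in the Mumford–Tate group `MT(V^n_{(F,Π)})(ℚ)` — the reflex norm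
lands in the torus `T_Π` (FILE 1) and `T_Π(ℚ) = MT(V^n_{(F,Π)})(ℚ)` (g26-#2). [cite: GreenGriffithsKerr2012, (V.D.4) p. 164]
[cite: Deligne1982HodgeCycles, I Example 3.7 (b), (c)] -/
theorem mulRight_reflexNormHom_mem_mumfordTateGroup_ofOrientation (α : (Λ.reflexField ι)ˣ) :
    LinearEquiv.ofLinear (LinearMap.mulRight ℚ ((Λ.reflexNormHom j ι α : Mˣ) : M))
        (LinearMap.mulRight ℚ ((Λ.reflexNormHom j ι α : Mˣ) : M)⁻¹)
        (LinearMap.ext fun v => by simp)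
        (LinearMap.ext fun v => by simp) ∈
      (ofOrientation Λ).mumfordTateGroup :=
  mulRight_mem_mumfordTateGroup_ofOrientation Λ (Λ.reflexNormHom j ι α).ne_zero fun c hc =>
    Λ.prod_embedding_reflexNormHom_zpow_eq_one j ι α c hc

/-- The same as an existence statement free of the `LinearEquiv` packaging: some `g ∈ MT(V^n_{(F,Π)})(ℚ)` is multiplication by
`N_{Π′}(α)` (`g(v) = v · N_{Π′}(α)`, `g(1) = N_{Π′}(α)`). [cite: GreenGriffithsKerr2012, (V.D.4) p. 164] -/
theorem exists_mem_mumfordTateGroup_ofOrientation_apply_one_eq_reflexNormHom (α : (Λ.reflexField ι)ˣ) :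
    ∃ g ∈ (ofOrientation Λ).mumfordTateGroup, (∀ v : M, g v = v * g 1) ∧ g 1 = ((Λ.reflexNormHom j ι α : Mˣ) : M) :=
  ⟨_, Λ.mulRight_reflexNormHom_mem_mumfordTateGroup_ofOrientation j ι α, fun v => by
    simp only [LinearEquiv.ofLinear_apply, LinearMap.mulRight_apply, one_mul], by
    simp only [LinearEquiv.ofLinear_apply, LinearMap.mulRight_apply, one_mul]⟩

end Orientation

end HodgeStructure

end Literature.AlgebraicGeometry.Motives
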